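import Literature.NumberTheory.GaloisRepresentations.ArtinCharacterReciprocity
import Literature.NumberTheory.GaloisRepresentations.AbsGaloisGroup
import Literature.NumberTheory.Automorphic.BookerKrishnamurthyConverse
import HarnessLib

/-!
# Artin reciprocity for a character at the real places (named fact, D-0014)

Topic `NumberTheory/GaloisRepresentations` (class field theory; companion of
`ArtinCharacterReciprocity`, whose named fact `artinReciprocity_character` — DISCHARGED in
`ArtinCharacterReciprocityProofs` — attaches to a rank-one Artin representation `χ : Γ_K → GL_1(ℂ)`
a finite-order Hecke character `ω` with the same local data at every finite place where `χ` is
unramified: `ω` unramified and `ω(ϖ_v) = χ(Frob_v)`).  That fact says nothing at the ARCHIMEDEAN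
places.  The present file records the missing archimedean clause of the same reciprocity law:

* `artinReciprocity_character_archimedean` (named fact): if `ω` is attached to `χ` in the above
  sense, then at every REAL place `w` of `K` the archimedean component `ω_w : K_wˣ = ℝˣ → ℂˣ`
  (`HeckeCharacter.archComponent`, `BookerKrishnamurthyConverse`) takes at `-1` the value
  `det χ(c_w) = χ(c_w) ∈ {±1}` for every complex conjugation `c_w ∈ Γ_K` attached to `w`
  (`IsComplexConjugationAt`, `AbsGaloisGroup`).

Why it is true (Tate, *Global class field theory*, Ch. VII of Cassels–Fröhlich): the Artin map is the
product of the local Artin maps, `ψ_{L/K}(x) = ∏_v ψ_v(x_v)` (§6.3), and at a real place `v` the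
local reciprocity isomorphism `K_v^*/N(L^v)^* ≅ G(L^v/K_v)` (§6.3–6.4, "the Main Theorem of 5.1 is
true locally") is `ℝˣ/ℝ_{>0} ≅ Gal(ℂ/ℝ)` when `L^v = ℂ`, i.e. `ψ_v(-1)` is the complex conjugation of
the decomposition group at `v` (and `ψ_v = 1` when `L^v = ℝ`, where the complex conjugations at `v`
are trivial on `L`); here `L = K̄^{ker χ}` and `ω = χ ∘ ψ_{L/K}`.  The hypothesis pins `ω` down
uniquely: two Hecke characters that are unramified with the same value at the uniformizer at all
but finitely many places coincide (weak approximation and continuity), so the `ω` of the hypothesis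
IS `χ ∘ ψ_{L/K}`, whose real components are the ones described.

Mathlib / tree search: Mathlib (this pin) has no global class field theory; the tree has the
finite-place reciprocity (`artinReciprocity_character_holds`) built from the ideal-theoretic Artin
map with a modulus (`ArtinReciprocityCyclic`, `ArtinCharacterReciprocityProofs`), in which the real
places enter only through total positivity of the ray (`IdeleHerbrand`), and no statement relating
`ω` on `K_∞ˣ` to complex conjugations (grep `IsComplexConjugation` in the Hecke-character files:
nothing).  Consumed by the crux `QuadraticWindow.HostInducedRep` (stmt-Langlands-10902, line
`one-transparent-pane`): the parity hypotheses of that crux are phrased on the Galois side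
(`det e(c)` at complex conjugations) while the archimedean type of the Hecke characters built from the
Artin avatars is what decides `C`-algebraicity.

## References

* J. Tate, *Global class field theory*, Ch. VII of J. W. S. Cassels, A. Fröhlich (eds.),
  *Algebraic Number Theory* (1967): §5.1 Main Theorem, §6.3 (local Artin maps, `ψ = ∏ ψ_v`),
  §6.4. [CasselsFrohlichANT1967]
* J. Neukirch, *Algebraic Number Theory* (1999), Ch. VI §5 (the norm residue symbol over `ℝ`).
  [NeukirchANT1999]
-/

noncomputable section

open NumberField Polynomial IsDedekindDomain

namespace Literature.NumberTheory.GaloisRepresentations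

open Literature.NumberTheory.Automorphic

/-- **Artin reciprocity for a character, archimedean clause** (Tate, Cassels–Fröhlich Ch. VII
§6.3–6.4 with §5.1: the global Artin map is the product of the local ones, and at a real place `v`
with `L^v = ℂ` the local map `ℝˣ/ℝ_{>0} ≅ Gal(ℂ/ℝ)` sends `-1` to complex conjugation).  For a number
field `K`, a rank-one Artin representation `χ` of `Γ_K` and a Hecke character `ω` of `K` attached to
`χ` at the finite places (unramified with `χ(Frob_v) = ω(ϖ_v)` wherever `χ` is unramified — the
conclusion of `artinReciprocity_character`, which determines `ω`), at every real place `w` of `K`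
and for every complex conjugation `c` of `Γ_K` at `w`: `ω_w(-1) = det χ(c)` (`= χ(c) = ±1`).
[cite: CasselsFrohlichANT1967, Ch. VII §6.3–6.4 and §5.1] -/
def artinReciprocity_character_archimedean : Prop :=
  ∀ (K : Type) [Field K] [NumberField K] (χ : FramedArtinRep K 1) (ω : HeckeCharacter K),
    (∀ v : HeightOneSpectrum (𝓞 K), χ.IsUnramifiedAt v →
      ω.IsUnramifiedAt v ∧ χ.HasFrobCharpolyAt v (X - C (ω.valueAtUniformizer v))) →
    ∀ (w : InfinitePlace K) (hw : w.IsReal) (c : Field.absoluteGaloisGroup K),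
      IsComplexConjugationAt hw c →
        ω.archComponent w (-1) = Matrix.GeneralLinearGroup.det (χ c)

/-- Unfolding lemma for `artinReciprocity_character_archimedean`. [folklore] -/
theorem artinReciprocity_character_archimedean_iff :
    artinReciprocity_character_archimedean ↔
      ∀ (K : Type) [Field K] [NumberField K] (χ : FramedArtinRep K 1) (ω : HeckeCharacter K),
        (∀ v : HeightOneSpectrum (𝓞 K), χ.IsUnramifiedAt v →
          ω.IsUnramifiedAt v ∧ χ.HasFrobCharpolyAt v (X - C (ω.valueAtUniformizer v))) →
        ∀ (w : InfinitePlace K) (hw : w.IsReal) (c : Field.absoluteGaloisGroup K),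
          IsComplexConjugationAt hw c →
            ω.archComponent w (-1) = Matrix.GeneralLinearGroup.det (χ c) :=
  Iff.rfl

end Literature.NumberTheory.GaloisRepresentations

end
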